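import Summits.AnomalousDissipation.AnomalousDissipation.Theorems.BaireTransferDenseLoudDesignerForcesErgodicLine
import Literature.Dynamics.Hyperbolic.HyperbolicSemiflowModel

/-!
# Line `ergodic-budget-selection-closing` (crux `BaireTransfer.DenseLoudDesignerForces`, stmt-AnomalousDissipation-1143):
# smooth models of an NS phase and the transport of the closing lemma (block G of Stub 2)

Stub 2 of the line (`stub_closingLemma`: a hyperbolic invariant measure `μ` of an NS phase `(K, φ)` has the Katok closing
property `HasKatokClosing K' φ' μ` in an enlarged NS phase `(K', φ')`) factors — scout report
`Cruxes/DenseLoudDesignerForces/Lines/ergodic-budget-selection-closing-chartEncoding-scout.md`, lead c3-0/c4-0, 2026-08-16 — as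

  `Stub 2 = G ∘ (N, D)`:
  * N (registered stub `stub_smoothModel`, Navier–Stokes analysis): the enlarged NS phase `(K', φ')` admits a SMOOTH MODEL — an
    injective bounded operator `Smap : H →L[ℝ] H` (intended: `(1 + A)⁻¹`, `A` the Stokes operator) conjugating a `C²` local
    semiflow `g` on an open set `U ⊆ H` near a compact invariant set `Λ` carrying `m`, `(Smap)_* m = μ`, to `φ'` on `Smap '' Λ ⊆ K'`,
    such that `(U, Λ, g, m)` is an `IsHyperbolicSemiflowModel` (Literature interface, Lian–Young 2012 §1 standing hypotheses) and
    every closed orbit of `g` inside `U` is carried into `K'` (the phase-enlargement guarantee);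
  * D (registered stub `stub_ambientClosing`, smooth ergodic theory in Hilbert space): `IsHyperbolicSemiflowModel U Λ g m →
    HasAmbientClosing U Λ g m` (Katok 1980 Main Lemma in finite dimension; Lian–Young 2012 for semiflows on Hilbert spaces);
  * G (THIS FILE, proved): `IsSmoothModelOf K' φ' μ Smap U Λ g m → HasAmbientClosing U Λ g m → HasKatokClosing K' φ' μ`.

This file defines the interface `IsSmoothModelOf` (exactly the five properties G consumes — no smoothness axiom is needed to
TRANSPORT a closing statement) and proves G: Pesin sets are transported as compact images `Smap '' P_ℓ` (closed, hence Borel),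
their `μ`-conullity is `(Smap)_* m = μ`, the return radius on `Smap '' P_ℓ` is the positive minimum of `dist (Smap a) (Smap b)` on the
compact set `{(a, b) ∈ P_ℓ × P_ℓ | δ ≤ dist a b}` (injectivity of `Smap`), the accuracy is `η / (‖Smap‖ + 1)`, closed orbits are
transported by the enlargement guarantee and distances by `‖Smap v‖ ≤ C ‖v‖`.  Nothing is asserted.

References: A. Katok, Publ. IHÉS 51 (1980) §3 (Main Lemma); Z. Lian, L.-S. Young, JAMS 25 (2012) §1; L. Barreira, Ya. Pesin,
*Introduction to Smooth Ergodic Theory* (2023) §11.2; the Literature interface `Literature/Dynamics/Hyperbolic/HyperbolicSemiflowModel.lean`.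
-/

set_option linter.dupNamespace false

noncomputable section

open scoped Topology
open Filter Set Function MeasureTheory Metric

namespace Summit.AnomalousDissipation.AnomalousDissipation.Theorems.DenseLoudDesignerForces.Ergodic

open Literature.Dynamics.Hyperbolic

/-! ## §1 The interface: a smooth model of (an enlargement of) an NS phase -/

/-- **Smooth model of the phase `(K', φ')` carrying `μ`** (interface of block N of Stub 2; the intended instance is the
Navier–Stokes strong-solution semiflow read through the smoothing isomorphism `Smap = (1 + A)⁻¹ : H → D(A)`).
`Smap : H →L[ℝ] H` is injective; it carries the model set `Λ` into `K'` and the model measure `m` to `μ`; it conjugates the model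
semiflow `g` to `φ'` on `Λ` at non-negative times; and — the PHASE-ENLARGEMENT GUARANTEE — every closed orbit of `g` that stays in
`U` is carried onto a trajectory of `φ'` inside `K'`.  (The analytic content — `(U, Λ, g, m)` is an `IsHyperbolicSemiflowModel` — is
kept as a separate conjunct of block N, since the transport theorem G below does not use it.) [folklore] -/
@[folklore] structure IsSmoothModelOf (K' : Set Hsp) (φ' : ℝ → Hsp → Hsp) (μ : Measure Hsp) (Smap : Hsp →L[ℝ] Hsp)
    (U Λ : Set Hsp) (g : ℝ → Hsp → Hsp) (m : Measure Hsp) : Prop where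
  /-- The smoothing map is injective. -/
  injective : Function.Injective Smap
  /-- The model set is carried into the phase. -/
  image_subset : Smap '' Λ ⊆ K'
  /-- The model measure is carried to `μ`. -/
  map_eq : Measure.map Smap m = μ
  /-- Conjugacy on `Λ` at non-negative times. -/
  conj : ∀ t : ℝ, 0 ≤ t → ∀ y ∈ Λ, Smap (g t y) = φ' t (Smap y)
  /-- Phase-enlargement guarantee: closed orbits of the model inside `U` are carried onto trajectories of `φ'` in `K'`. -/
  closedOrbit : ∀ z ∈ U, ∀ T : ℝ, 0 < T → (∀ t ∈ Icc 0 T, g t z ∈ U) → g T z = z →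
    Smap z ∈ K' ∧ ∀ t : ℝ, 0 ≤ t → φ' t (Smap z) = Smap (g t z)

/-! ## §2 Block G: transport of the ambient closing lemma through a smooth model -/

/-- Uniform continuity of the inverse of an injective bounded operator on a compact set, in the form G needs: for every
`δ > 0` there is `δ' > 0` such that points of the compact set `P` whose images are `δ'`-close are `δ`-close (the positive minimum
of `dist (Smap a) (Smap b)` on the compact set `{(a,b) ∈ P × P | δ ≤ dist a b}`). [folklore] -/
theorem exists_dist_lt_of_dist_image_lt {P : Set Hsp} (hP : IsCompact P) (Smap : Hsp →L[ℝ] Hsp)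
    (hinj : Function.Injective Smap) {δ : ℝ} (hδ : 0 < δ) :
    ∃ δ' : ℝ, 0 < δ' ∧ ∀ a ∈ P, ∀ b ∈ P, dist (Smap a) (Smap b) < δ' → dist a b < δ := by
  set C : Set (Hsp × Hsp) := (P ×ˢ P) ∩ {q | δ ≤ dist q.1 q.2} with hC_def
  have hC : IsCompact C := (hP.prod hP).inter_right (isClosed_le continuous_const continuous_dist)
  have hf : Continuous fun q : Hsp × Hsp => dist (Smap q.1) (Smap q.2) := by fun_prop
  by_cases hCne : C.Nonempty
  · obtain ⟨q₀, hq₀, hmin⟩ := hC.exists_isMinOn hCne hf.continuousOn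
    refine ⟨dist (Smap q₀.1) (Smap q₀.2), ?_, ?_⟩
    · refine dist_pos.2 fun h => ?_
      have hq : δ ≤ dist q₀.1 q₀.2 := hq₀.2
      rw [hinj h, dist_self] at hq
      exact absurd hq (not_le.2 hδ)
    · intro a ha b hb hab
      by_contra hlt
      push Not at hlt
      have hmem : (a, b) ∈ C := ⟨⟨ha, hb⟩, hlt⟩
      have hle := hmin hmem
      simp only [mem_setOf_eq] at hle
      exact absurd hle (not_le.2 hab)
  · refine ⟨1, one_pos, fun a ha b hb _ => ?_⟩
    by_contra hlt
    push Not at hlt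
    exact hCne ⟨(a, b), ⟨ha, hb⟩, hlt⟩

/-- **Block G of Stub 2 — transport of the closing lemma through a smooth model.**  If `(Smap, U, Λ, g, m)` is a smooth
model of the phase `(K', φ')` carrying `μ` and the model semiflow has the ambient Katok closing property along compact Pesin
sets (`HasAmbientClosing`, the output shape of the closing lemma of Katok 1980 / Lian–Young 2012), then `μ` has the Katok
closing property in `(K', φ')` (`HasKatokClosing`): Pesin sets `Smap '' P_ℓ`, return radius from
`exists_dist_lt_of_dist_image_lt`, accuracy `η / max C 1` (`‖Smap v‖ ≤ C‖v‖`, `ContinuousLinearMap.bound`). [folklore] -/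
theorem hasKatokClosing_of_smoothModel {K' : Set Hsp} {φ' : ℝ → Hsp → Hsp} {μ : Measure Hsp} {Smap : Hsp →L[ℝ] Hsp}
    {U Λ : Set Hsp} {g : ℝ → Hsp → Hsp} {m : Measure Hsp}
    (hS : IsSmoothModelOf K' φ' μ Smap U Λ g m) (hcl : HasAmbientClosing U Λ g m) : HasKatokClosing K' φ' μ := by
  obtain ⟨P, hPc, hPΛ, hPnull, hclose⟩ := hcl
  have hmeasP : ∀ ℓ, MeasurableSet (Smap '' P ℓ) := fun ℓ =>
    ((hPc ℓ).image Smap.continuous).isClosed.measurableSet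
  refine ⟨fun ℓ => Smap '' P ℓ, hmeasP, fun ℓ => (image_mono (hPΛ ℓ)).trans hS.image_subset, ?_, ?_⟩
  · -- the transported Pesin sets exhaust `μ`-almost everything
    by_cases hae : AEMeasurable Smap m
    · rw [← hS.map_eq, Measure.map_apply_of_aemeasurable hae (MeasurableSet.iUnion hmeasP).compl]
      refine measure_mono_null (fun y hy => ?_) hPnull
      simp only [mem_preimage, mem_compl_iff, mem_iUnion, not_exists] at hy ⊢
      exact fun ℓ hyℓ => hy ℓ (mem_image_of_mem _ hyℓ)
    · have hμ : μ = 0 := by rw [← hS.map_eq, Measure.map_of_not_aemeasurable hae]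
      simp [hμ]
  · intro ℓ η hη
    obtain ⟨C, hC, hbound⟩ := Smap.bound
    set M : ℝ := max C 1 with hM_def
    have hM1 : 1 ≤ M := le_max_right _ _
    have hM : 0 < M := lt_of_lt_of_le one_pos hM1
    have hCM : C ≤ M := le_max_left _ _
    obtain ⟨δ, hδ, hret⟩ := hclose ℓ (η / M) (div_pos hη hM)
    obtain ⟨δ', hδ', hsep⟩ := exists_dist_lt_of_dist_image_lt (hPc ℓ) Smap hS.injective hδ
    refine ⟨δ', hδ', ?_⟩
    rintro x' ⟨x, hx, rfl⟩ n hn hback hdist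
    have hconj : ∀ k : ℕ, φ' k (Smap x) = Smap (g k x) := fun k =>
      (hS.conj k (Nat.cast_nonneg k) x (hPΛ ℓ hx)).symm
    rw [hconj n] at hback hdist
    obtain ⟨y, hy, hyx⟩ := hback
    have hgy : g n x = y := (hS.injective hyx).symm
    have hd : dist (g (n : ℝ) x) x < δ := hsep _ (hgy ▸ hy) _ hx hdist
    obtain ⟨z, hzU, T, hT, hTn, horb, hfix, hshadow⟩ := hret x hx n hn (hgy ▸ hy) hd
    obtain ⟨hzK', hconjz⟩ := hS.closedOrbit z hzU T hT horb hfix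
    refine ⟨Smap z, hzK', T, hT, hTn.trans (div_le_self hη.le hM1), ?_, fun k hk => ?_⟩
    · rw [hconjz T hT.le, hfix]
    · rw [hconjz k (Nat.cast_nonneg k), hconj k, dist_eq_norm, ← map_sub]
      have hηM : 0 ≤ η / M := (div_pos hη hM).le
      calc ‖Smap (g k z - g k x)‖ ≤ C * ‖g k z - g k x‖ := hbound _
        _ ≤ M * (η / M) := by
            apply mul_le_mul hCM _ (norm_nonneg _) hM.le
            rw [← dist_eq_norm]; exact hshadow k hk
        _ = η := by field_simp

/-- **Registered stub G** (`ledger workitem` stub `stub_closingOfSmoothModel` of crux stmt-AnomalousDissipation-1143, line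
`ergodic-budget-selection-closing`): the transport theorem `hasKatokClosing_of_smoothModel` under its registered name. [folklore] -/
theorem stub_closingOfSmoothModel {K' : Set Hsp} {φ' : ℝ → Hsp → Hsp} {μ : Measure Hsp} {Smap : Hsp →L[ℝ] Hsp} {U Λ : Set Hsp} {g : ℝ → Hsp → Hsp} {m : Measure Hsp} (hS : IsSmoothModelOf K' φ' μ Smap U Λ g m) (hcl : HasAmbientClosing U Λ g m) : HasKatokClosing K' φ' μ :=
  hasKatokClosing_of_smoothModel hS hcl

end Summit.AnomalousDissipation.AnomalousDissipation.Theorems.DenseLoudDesignerForces.Ergodic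

end
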